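import Summits.Langlands.Langlands.Theses.IrreducibilityBySelfDuality
import Summits.Langlands.Langlands.Theorems.RegularTwistCM.Negative.ArchShadow
import Summits.Langlands.Langlands.Theorems.RegularTwistCM.Negative.ArchShadowParity
import Literature.NumberTheory.Automorphic.AutomorphicRepsGLOneArchParameter
import Literature.NumberTheory.Automorphic.KimExteriorSquareGL4ArchimedeanTwist
import Literature.NumberTheory.Automorphic.HermitianArchParameter

/-!
# Line `unitary-mirror-parity` — checked skeleton for the crux
`Summit.Langlands.Langlands.Theses.IrreducibilityBySelfDuality.RegularTwistCM` (stmt-Langlands-14069)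

Planner crux-plan, round 1 (idea card `Cruxes/RegularTwistCM/Ideas/unitary-mirror-parity.md`, line card
`Cruxes/RegularTwistCM/Lines/unitary-mirror-parity.md`). Six registered stubs `stub_*` (the only `sorry`s of
the file) and the kernel-checked composition `RegularTwistCM_of : RegularTwistCM`, a closed proof over the six
stubs whose logical shape is

  `UnitaryMirror → AdjointArchShadow → DescentInfinityType → CentralCharacterDatum →
     HalfIntegralTwistCM → TwistRealisation → RegularTwistCM`

(the fifth antecedent is the route's own item `HalfIntegralTwistCM`, stmt-Langlands-14036, BY NAME, entering through
`stub_halfIntegralTwist`).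

Shape of the line (the crux is FIXED; all work is at Harish-Chandra-parameter level, no Langlands parameters,
no unitary dual of `GL₂(ℂ)`, no Clozel package):

* `stub_unitaryMirror` — THE LEVER (card `unitary-mirror-parity` ≈ `petersson-hermitian-purity`): for EVERY
  cuspidal Borel–Jacquet datum `π` on `GL_n(𝔸_K)` with archimedean parameter `P`, there is ONE real `c` with
  `P(ῑ) = {-z̄ + c : z ∈ P(ι)}` at every complex embedding `ι`. In-tree engine:
  `HasArchParameter.map_neg_conj_of_skewHermitian` (Lie level, proved) + the Petersson pairing
  (`AutomorphyDatum.l2Pairing_lieDeriv_add_eq_zero`, `AdelicGroupData.eq_zero_of_l2Pairing_self_eq_zero`,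
  `AutomorphicRepsGL.cuspidal_bounded_holds`, all proved) on the clean `A_G`-normalised model
  (`exists_clean_hasSatakeParamAt_hasArchParameter_of_sSup_irreducible`, `exists_apply_posRealScalar_mul_eq_cpow`,
  `HasArchParameter.of_map_mulChar_detTwist`); `c = -2 Re s₀` for the normalising exponent `s₀`.
* `stub_adjointArchShadow` — INPUT (Gelbart–Jacquet 1978 Thm (9.3)(2)-(3) AT THE ARCHIMEDEAN PLACES + Jacquet–
  Shalika 1981 II Thm 4.4, rendered on Harish-Chandra multisets; the tree's `GelbartJacquet_adjoint_lift` /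
  `GelbartJacquet_symmSq_*` are Satake-level only): under the crux's a.e. hypothesis `t_π = d · Ad(t_{σ₀})`,
  `HC(π)(ι) = {x - y + q, q, y - x + q}` whenever `HC(σ₀)(ι) = {x, y}`, `HC(ν)(ι) = {q}`.
* `stub_descentInfinityType` — INPUT (Clozel 1990 §3.3 / Knapp Thm 5.44 / Borel–Jacquet 4.6 for `n = 2`; the
  tree's named fact `AutomorphicRepData.exists_hasInfinityType`, instance `σ₀`): the cuspidal `GL₂` datum has a
  WELL-FORMED infinity type — this is exactly the INTEGRAL PAIRING `s₁ ι - s₁ ῑ ∈ ℤ` that the triage panel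
  (TRIAGE-r1-1 §A witness `{1/4, 5/4} / {-1/4, -5/4}`) showed to be independent of mirror + purity + integrality.
* `stub_centralCharacterDatum` — the central character of a cuspidal `GL_n` datum is a `GL(1)` datum whose
  archimedean parameter is the SUM of the Harish-Chandra parameter, embedding by embedding (in-tree pieces:
  `GLnCentralCharacter.exists_centralCharacter`, `HasHCParameter.apply_one`, `hasArchParameter_glOne_of_eq_smul_one`).
* `stub_halfIntegralTwist` — the route item `HalfIntegralTwistCM` (crux r4, stmt-Langlands-14036) by name: the
  GL(1)/CM lever (Weil's unit criterion on `U²` + Chevalley); this is where `IsCMField` is consumed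
  (`Disproof.regularTwistCM_false_without_IsCMField` honoured here) and where `squares_trick(_tight)` lives.
* `stub_twistRealisation` — the arch-aware twist of a cuspidal `GL_n` datum by a `GL(1)` datum: Satake
  parameters multiply a.e. (in tree for Hecke characters: `CuspidalAutomorphicRepData.exists_twist_hecke_hasSatakeParamAt`),
  archimedean parameters shift by the `z`-exponent (in tree for `|det|^s`, `s ∈ ℝ`:
  `HasArchParameter.of_map_mulChar_detTwist`; the general case is Disproof F1's "formalisation depth").

PROVED here (no sorry): the archimedean parameter of the `GL(1)` datum `ν` exists
(`AutomorphicRepData.exists_hasArchParameter_glOne`, tree); extraction of paired exponent FUNCTIONS `s₁, s₂`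
from a well-formed rank-2 infinity type (`exists_paired_exponents_of_hasInfinityType`); integrality
`s₁ ι - s₂ ι ∈ ℤ`, `q ∈ ℤ` and regularity `s₁ ι ≠ s₂ ι` from `π` regular algebraic through the shadow; the
PARITY `(s₁-s₂)(ι) + (s₁-s₂)(ῑ) ∈ 2ℤ` from the mirror (`parity_of_mirror`: `b = ∓a`, sign irrelevant — Disproof
F6 `cmParity_sufficient`); assembly of the four hypotheses of `HalfIntegralTwistCM`; and the REGULAR ALGEBRAIC
CERTIFICATE of `σ = σ₀ ⊗ χ` (an explicit well-formed `InfinityType K 2` with exponents in `1/2 + ℤ`, distinct).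

Negative lemmas checked against (imported): `Theorems/RegularTwistCM/Negative/ArchShadow.lean`,
`…/ArchShadowParity.lean` — no stub is an instance they refute (they are exponent shadows; the stubs never ask
for an algebraic `χ` (F4/F8), never a place-independent `Σ_w` (F2), never triviality on `U` rather than `U²`).
-/

set_option linter.dupNamespace false
set_option linter.unusedVariables false

noncomputable section

-- (H5 of the tree's archimedean files: the place subtypes indexing `mixedSpace K` are `Fintype` classically)
open scoped ComplexConjugate Classical
open NumberField Filter

namespace Summit.Langlands.Langlands.Cruxes.RegularTwistCM.UnitaryMirrorParity

open Literature.NumberTheory.Automorphic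

/-! ## The statements of the six stubs -/

/-- **Stub 1 statement — the unitary mirror (Hermitian symmetry of the archimedean parameter of a CUSPIDAL
datum).** For every cuspidal Borel–Jacquet datum `π` on `GL_n(𝔸_K)` (`n ≥ 1`, any number field) with
archimedean parameter `P`, there is a real `c` with `P(ῑ) = (P ι).map (z ↦ -z̄ + c)` for every complex
embedding `ι` (`c = -2 Re s₀`, `s₀` the exponent with `π ⊗ |det|^{s₀}` `A_G`-invariant; at a real place
`ῑ = ι`). Paper: Knapp–Vogan 1995 Ch. IX §1 (0.5); Borel–Jacquet 1979, 5.7; Clozel 1990 Lemme 4.9 (proof). -/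
def UnitaryMirror : Prop :=
  ∀ (n : ℕ) [NeZero n] (K : Type) [Field K] [NumberField K] (hcpt : isCompact_glFiniteIntegralLevel n K)
    (π : CuspidalAutomorphicRepData n K hcpt) (P : (K →+* ℂ) → Multiset ℂ), π.1.HasArchParameter P →
      ∃ c : ℝ, ∀ ι : K →+* ℂ,
        P (ComplexEmbedding.conjugate ι) = (P ι).map (fun z => -conj z + (c : ℂ))

/-- **Stub 2 statement — the adjoint archimedean shadow (INPUT: Gelbart–Jacquet at `∞` + Jacquet–Shalika II
Thm 4.4, on Harish-Chandra multisets).** For cuspidal `π` (GL₃), `σ₀` (GL₂), `ν` (GL₁) over ANY number field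
with `t_π = d · Ad(t_{σ₀})` a.e. (the crux's hypothesis verbatim), and any archimedean parameters `χπ, χσ, χν`
of the three data: at every embedding `ι`, if `χσ ι = {x, y}` and `χν ι = {q}` then
`χπ ι = {x - y + q, q, y - x + q}` (`π_w ≅ Ad(σ₀,w) ⊗ ν_w`; the dihedral case is vacuous since a cuspidal `π`
is not nearly equivalent to an isobaric non-cuspidal representation). -/
def AdjointArchShadow : Prop :=
  ∀ (K : Type) [Field K] [NumberField K]
    (h1 : isCompact_glFiniteIntegralLevel 1 K) (hcpt₂ : isCompact_glFiniteIntegralLevel 2 K)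
    (hcpt : isCompact_glFiniteIntegralLevel 3 K)
    (π : CuspidalAutomorphicRepData 3 K hcpt) (σ₀ : CuspidalAutomorphicRepData 2 K hcpt₂)
    (ν : CuspidalAutomorphicRepData 1 K h1),
    (∀ᶠ v in cofinite, ∀ α β : Multiset ℂ, π.1.HasSatakeParamAt v α →
      σ₀.1.HasSatakeParamAt v β → ∃ d : ℂ, ν.1.HasSatakeParamAt v {d} ∧
        α = (((β ×ˢ β).map (fun r : ℂ × ℂ => r.1 * r.2⁻¹)).erase 1).map (fun e => d * e)) →
    ∀ (χπ χσ χν : (K →+* ℂ) → Multiset ℂ),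
      π.1.HasArchParameter χπ → σ₀.1.HasArchParameter χσ → ν.1.HasArchParameter χν →
      ∀ (ι : K →+* ℂ) (x y q : ℂ), χσ ι = {x, y} → χν ι = {q} →
        χπ ι = {x - y + q, q, y - x + q}

/-- **Stub 3 statement — the descent datum has a well-formed infinity type (INPUT: Clozel 1990 §3.3 for
`n = 2`, = the tree's named fact `AutomorphicRepData.exists_hasInfinityType` on the instance `σ₀`).** This is
the INTEGRAL PAIRING of the Harish-Chandra parameter of `σ₀` (`s_i ι - s_i ῑ ∈ ℤ` for a suitable labelling),
the archimedean input the triage panel proved independent of mirror/purity/integrality. -/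
def DescentInfinityType : Prop :=
  ∀ (K : Type) [Field K] [NumberField K] (hcpt₂ : isCompact_glFiniteIntegralLevel 2 K)
    (σ₀ : CuspidalAutomorphicRepData 2 K hcpt₂), σ₀.1.exists_hasInfinityType

/-- **Stub 4 statement — the central character as a `GL(1)` datum, archimedean clause.** For a cuspidal
datum `π` on `GL_n(𝔸_K)` (`n ≥ 1`) with archimedean parameter `P` there is a cuspidal `GL(1)` datum `ω`
(the central character `ω_π`, a Hecke character) whose archimedean parameter at `ι` is `{∑ P(ι)}` (the
central `1_w ∈ 𝔤𝔩_n(K_w)` acts at the embedding `ι` through `γ(E_ι) = ∑_i x_{ι,i}`). -/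
def CentralCharacterDatum : Prop :=
  ∀ (n : ℕ) [NeZero n] (K : Type) [Field K] [NumberField K]
    (h1 : isCompact_glFiniteIntegralLevel 1 K) (hcpt : isCompact_glFiniteIntegralLevel n K)
    (π : CuspidalAutomorphicRepData n K hcpt) (P : (K →+* ℂ) → Multiset ℂ), π.1.HasArchParameter P →
      ∃ ω : CuspidalAutomorphicRepData 1 K h1, ω.1.HasArchParameter (fun ι => {(P ι).sum})

/-- **Stub 6 statement — twist of a cuspidal `GL_n` datum by a `GL(1)` datum, with its archimedean
parameter.** For cuspidal `π` on `GL_n(𝔸_K)` with archimedean parameter `P` and a cuspidal `GL(1)` datum `χ`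
with archimedean parameter `ι ↦ {p ι}`, there is a cuspidal datum `π' = π ⊗ χ` with archimedean parameter
`ι ↦ P(ι) + p ι` and, at almost every finite place, `t_{π'} = c_v · t_π` where `{c_v}` is the Satake parameter
of `χ`. (Satake half in tree for Hecke characters; the archimedean half is the general-character version of
`HasArchParameter.of_map_mulChar_detTwist`.) -/
def TwistRealisation : Prop :=
  ∀ (n : ℕ) [NeZero n] (K : Type) [Field K] [NumberField K]
    (h1 : isCompact_glFiniteIntegralLevel 1 K) (hcpt : isCompact_glFiniteIntegralLevel n K)
    (π : CuspidalAutomorphicRepData n K hcpt) (χ : CuspidalAutomorphicRepData 1 K h1)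
    (P : (K →+* ℂ) → Multiset ℂ) (p : (K →+* ℂ) → ℂ),
    π.1.HasArchParameter P → χ.1.HasArchParameter (fun ι => {p ι}) →
      ∃ π' : CuspidalAutomorphicRepData n K hcpt,
        π'.1.HasArchParameter (fun ι => (P ι).map (· + p ι)) ∧
        ∀ᶠ v in cofinite, ∀ β : Multiset ℂ, π.1.HasSatakeParamAt v β →
          ∃ c : ℂ, χ.1.HasSatakeParamAt v {c} ∧ π'.1.HasSatakeParamAt v (β.map (fun b => c * b))

/-! ## The six registered stubs (the only `sorry`s of the line) -/

/-- **stub_unitaryMirror** — THE LEVER [L; provable now: clean model + `A_G`-normalisation + Petersson pairing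
+ `HasArchParameter.map_neg_conj_of_skewHermitian`; needs the archimedean shift for a complex power `|det|^{s₀}`
(or real power + unitary imaginary power), `B v v ≠ 0` by `eq_zero_of_l2Pairing_self_eq_zero`]. -/
theorem stub_unitaryMirror : UnitaryMirror := by
  sorry

/-- **stub_adjointArchShadow** — INPUT [XL: Gelbart–Jacquet 1978 Thm (9.3) at `∞` + Jacquet–Shalika 1981 II
Thm 4.4 with archimedean components; no tree shadow beyond Satake level]. -/
theorem stub_adjointArchShadow : AdjointArchShadow := by
  sorry

/-- **stub_descentInfinityType** — INPUT [L/XL: `exists_hasInfinityType` for cuspidal `GL₂` data = existence of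
the infinitesimal character (Schur, `exists_hasArchParameter_of_hasInfinitesimalCharacter` proved) + the
INTEGRAL PAIRING from the archimedean classification (`K_w`-types integrate)]. -/
theorem stub_descentInfinityType : DescentInfinityType := by
  sorry

/-- **stub_centralCharacterDatum** [M/L: `exists_centralCharacter` + `HasHCParameter.apply_one` per place factor
+ the `GL(1)` datum of a Hecke character with `hasArchParameter_glOne_of_eq_smul_one`]. -/
theorem stub_centralCharacterDatum : CentralCharacterDatum := by
  sorry

/-- **stub_halfIntegralTwist** — the route item `HalfIntegralTwistCM` (stmt-Langlands-14036, crux r4) BY NAME: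
closes when that item closes (do not re-prove inside this line) [L: Weil's unit criterion on `U²`, Chevalley
1951 Thm 1 (m = 2), Weil/Neukirch extension; `IsCMField` and clause (ii) load-bearing]. -/
theorem stub_halfIntegralTwist :
    Summit.Langlands.Langlands.Theses.IrreducibilityBySelfDuality.HalfIntegralTwistCM := by
  sorry

/-- **stub_twistRealisation** [L: `exists_cuspidalAutomorphicRepData_twist_hecke` + Satake
`eventually_hasSatakeParamAt_of_map_mulChar_detTwist` + GL(1)-datum ↔ Hecke character
(`exists_heckeCharacter_glOne`, `exists_eq_singleton_of_hasSatakeParamAt_glOne`) + the archimedean shift of a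
general Hecke twist (generalising `lieRep_mulChar_twist` / `HasHCParameter.of_twist_norm`)]. -/
theorem stub_twistRealisation : TwistRealisation := by
  sorry

/-! ## Bookkeeping lemmas (proved) -/

/-- **Parity from the mirror** (Disproof F6: `b = ∓a`, the sign is irrelevant): if `{t₁, t₂} = {-s̄₁ + c,
-s̄₂ + c}` and `s₁ - s₂ = a ∈ ℤ` then `(s₁ - s₂) + (t₁ - t₂) ∈ 2ℤ` (it is `0` or `2a`). -/
theorem parity_of_mirror {s₁ s₂ t₁ t₂ : ℂ} {c : ℝ} {a : ℤ} (ha : s₁ - s₂ = a)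
    (h : ({t₁, t₂} : Multiset ℂ) = {-conj s₁ + (c : ℂ), -conj s₂ + (c : ℂ)}) :
    ∃ m : ℤ, (s₁ - s₂) + (t₁ - t₂) = 2 * m := by
  have hconj : conj s₁ - conj s₂ = (a : ℂ) := by
    rw [← map_sub, ha, map_intCast]
  rw [Multiset.insert_eq_cons, Multiset.insert_eq_cons, Multiset.cons_eq_cons] at h
  rcases h with ⟨h1, h2⟩ | ⟨-, cs, h2, h3⟩
  · rw [Multiset.singleton_inj] at h2
    refine ⟨0, ?_⟩
    rw [h1, h2, Int.cast_zero, mul_zero]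
    linear_combination ha - hconj
  · rw [Multiset.singleton_eq_cons_iff] at h2 h3
    obtain ⟨h2, -⟩ := h2
    obtain ⟨h3, -⟩ := h3
    refine ⟨a, ?_⟩
    rw [h2, ← h3]
    linear_combination ha + hconj

/-- **Paired exponent functions from a well-formed rank-2 infinity type.** If `σ₀` (any datum on `GL₂`) has
infinity type `T`, there are functions `s₁ s₂` on the complex embeddings with `{s₁ ι, s₂ ι}` the archimedean
parameter at `ι` and `s_i ι - s_i ῑ ∈ ℤ` (choose, above each place `w`, an enumeration `{ω₁, ω₂}` of
`T σ_w` and put `s_i σ_w = a(ω_i)`, `s_i σ̄_w = b(ω_i)`; at a real place `σ̄_w = σ_w`). -/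
theorem exists_paired_exponents_of_hasInfinityType {K : Type} [Field K] [NumberField K]
    {hcpt₂ : isCompact_glFiniteIntegralLevel 2 K} {σ₀ : AutomorphicRepData (AutomorphyDatum.gl 2 K hcpt₂)}
    {T : InfinityType K 2} (hT : σ₀.HasInfinityType T) :
    ∃ s₁ s₂ : (K →+* ℂ) → ℂ, σ₀.HasArchParameter (fun ι => {s₁ ι, s₂ ι}) ∧
      ∀ ι : K →+* ℂ, (∃ m : ℤ, s₁ ι - s₁ (ComplexEmbedding.conjugate ι) = m) ∧
        (∃ m : ℤ, s₂ ι - s₂ (ComplexEmbedding.conjugate ι) = m) := by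
  classical
  obtain ⟨⟨hcard, hswap⟩, harch⟩ := hT
  -- an enumeration of `T` above each place, read at the distinguished embedding `σ_w`
  have hex : ∀ w : InfinitePlace K, ∃ xy : ArchWeight × ArchWeight, T w.embedding = {xy.1, xy.2} := by
    intro w
    obtain ⟨x, y, hxy⟩ := Multiset.card_eq_two.mp (hcard w.embedding)
    exact ⟨(x, y), hxy⟩
  choose e he using hex
  -- the exponent functions
  let s₁ : (K →+* ℂ) → ℂ := fun ι =>
    if ι = (InfinitePlace.mk ι).embedding then (e (InfinitePlace.mk ι)).1.a else (e (InfinitePlace.mk ι)).1.b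
  let s₂ : (K →+* ℂ) → ℂ := fun ι =>
    if ι = (InfinitePlace.mk ι).embedding then (e (InfinitePlace.mk ι)).2.a else (e (InfinitePlace.mk ι)).2.b
  -- every embedding is `σ_w` or `σ̄_w`, `w = mk ι`
  have hdich : ∀ ι : K →+* ℂ, ι = (InfinitePlace.mk ι).embedding ∨
      (ι ≠ (InfinitePlace.mk ι).embedding ∧ ι = ComplexEmbedding.conjugate (InfinitePlace.mk ι).embedding) := by
    intro ι
    by_cases h : ι = (InfinitePlace.mk ι).embedding
    · exact Or.inl h
    · right
      refine ⟨h, ?_⟩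
      rcases InfinitePlace.mk_eq_iff.mp (InfinitePlace.mk_embedding (InfinitePlace.mk ι)) with h1 | h1
      · exact absurd h1.symm h
      · exact h1.symm
  -- the parameter multisets agree
  have hmul : ∀ ι : K →+* ℂ, ({s₁ ι, s₂ ι} : Multiset ℂ) = (T ι).map ArchWeight.a := by
    intro ι
    rcases hdich ι with h | ⟨hne, h⟩
    · have e1 : s₁ ι = (e (InfinitePlace.mk ι)).1.a := if_pos h
      have e2 : s₂ ι = (e (InfinitePlace.mk ι)).2.a := if_pos h
      rw [e1, e2]
      conv_rhs => rw [h, he (InfinitePlace.mk ι)]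
      simp
    · have e1 : s₁ ι = (e (InfinitePlace.mk ι)).1.b := if_neg hne
      have e2 : s₂ ι = (e (InfinitePlace.mk ι)).2.b := if_neg hne
      rw [e1, e2]
      conv_rhs => rw [h, hswap, he (InfinitePlace.mk ι)]
      simp
  refine ⟨s₁, s₂, ?_, fun ι => ?_⟩
  · have hfun : (fun ι : K →+* ℂ => ({s₁ ι, s₂ ι} : Multiset ℂ)) = fun ι => (T ι).map ArchWeight.a :=
      funext hmul
    rw [hfun]
    exact harch
  · -- the pairing
    have hmk : InfinitePlace.mk (ComplexEmbedding.conjugate ι) = InfinitePlace.mk ι :=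
      InfinitePlace.mk_conjugate_eq ι
    rcases hdich ι with h | ⟨hne, h⟩
    · by_cases hr : ComplexEmbedding.conjugate ι = ι
      · -- real place
        refine ⟨⟨0, ?_⟩, ⟨0, ?_⟩⟩ <;> simp [hr]
      · -- complex place, `ι = σ_w`: `ῑ` takes the `b`-branch
        have hne' : ComplexEmbedding.conjugate ι ≠ (InfinitePlace.mk (ComplexEmbedding.conjugate ι)).embedding := by
          rw [hmk, ← h]
          exact hr
        have e1 : s₁ ι = (e (InfinitePlace.mk ι)).1.a := if_pos h
        have e2 : s₂ ι = (e (InfinitePlace.mk ι)).2.a := if_pos h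
        have f1 : s₁ (ComplexEmbedding.conjugate ι) = (e (InfinitePlace.mk ι)).1.b := by
          show (if _ then _ else _) = _
          rw [if_neg hne', hmk]
        have f2 : s₂ (ComplexEmbedding.conjugate ι) = (e (InfinitePlace.mk ι)).2.b := by
          show (if _ then _ else _) = _
          rw [if_neg hne', hmk]
        rw [e1, e2, f1, f2]
        exact ⟨(e (InfinitePlace.mk ι)).1.exists_int_sub, (e (InfinitePlace.mk ι)).2.exists_int_sub⟩
    · -- complex place, `ι = σ̄_w`: `ῑ = σ_w` takes the `a`-branch
      have hci : ComplexEmbedding.conjugate ι = (InfinitePlace.mk ι).embedding :=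
        (congrArg ComplexEmbedding.conjugate h).trans (star_star _)
      have hpos : ComplexEmbedding.conjugate ι = (InfinitePlace.mk (ComplexEmbedding.conjugate ι)).embedding := by
        rw [hmk]
        exact hci
      have e1 : s₁ ι = (e (InfinitePlace.mk ι)).1.b := if_neg hne
      have e2 : s₂ ι = (e (InfinitePlace.mk ι)).2.b := if_neg hne
      have f1 : s₁ (ComplexEmbedding.conjugate ι) = (e (InfinitePlace.mk ι)).1.a := by
        show (if _ then _ else _) = _
        rw [if_pos hpos, hmk]
      have f2 : s₂ (ComplexEmbedding.conjugate ι) = (e (InfinitePlace.mk ι)).2.a := by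
        show (if _ then _ else _) = _
        rw [if_pos hpos, hmk]
      rw [e1, e2, f1, f2]
      obtain ⟨m₁, hm₁⟩ := (e (InfinitePlace.mk ι)).1.exists_int_sub
      obtain ⟨m₂, hm₂⟩ := (e (InfinitePlace.mk ι)).2.exists_int_sub
      exact ⟨⟨-m₁, by push_cast; linear_combination -hm₁⟩, ⟨-m₂, by push_cast; linear_combination -hm₂⟩⟩

/-! ## The composition: the six stubs imply the crux, by name (kernel-checked, no sorry of its own) -/

/-- **The line concludes the crux** — a closed proof over the six registered stubs (the audit admits no
other hypotheses): logically `UnitaryMirror → AdjointArchShadow → DescentInfinityType → CentralCharacterDatum →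
HalfIntegralTwistCM → TwistRealisation → RegularTwistCM`, the six antecedents being supplied by `stub_unitaryMirror`,
`stub_adjointArchShadow`, `stub_descentInfinityType`, `stub_centralCharacterDatum`, `stub_halfIntegralTwist`,
`stub_twistRealisation` in the first six lines and used nowhere else. Uses of the crux's hypotheses: `IsCMField`
only through `HalfIntegralTwistCM`; `π.1.IsRegularAlgebraic` for integrality (`s₁ ι - s₂ ι ∈ ℤ`, `q ι ∈ ℤ`) and
regularity (`s₁ ι ≠ s₂ ι`); the adjoint identity only through `AdjointArchShadow`. The twisting datum `χ` is
whatever `HalfIntegralTwistCM` returns (never asked to be algebraic: Disproof F4/F8 avoided). -/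
theorem RegularTwistCM_of :
    Summit.Langlands.Langlands.Theses.IrreducibilityBySelfDuality.RegularTwistCM := by
  -- the six stubs, once each
  have hM : UnitaryMirror := stub_unitaryMirror
  have hA : AdjointArchShadow := stub_adjointArchShadow
  have hD : DescentInfinityType := stub_descentInfinityType
  have hC : CentralCharacterDatum := stub_centralCharacterDatum
  have hH : Summit.Langlands.Langlands.Theses.IrreducibilityBySelfDuality.HalfIntegralTwistCM :=
    stub_halfIntegralTwist
  have hT : TwistRealisation := stub_twistRealisation
  intro K _ _ hCM h1 hcpt₂ hcpt π σ₀ ν hRA hAd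
  classical
  haveI : NeZero (2 : ℕ) := ⟨by norm_num⟩
  -- Step 1 (INPUT stub 3): paired exponent functions of `σ₀`
  obtain ⟨T₀, hT₀⟩ := hD K hcpt₂ σ₀
  obtain ⟨s₁, s₂, hσ, hpair⟩ := exists_paired_exponents_of_hasInfinityType hT₀
  -- Step 2 (tree): the archimedean parameter `{q ι}` of the `GL(1)` datum `ν`
  obtain ⟨χν, hχν⟩ := ν.1.exists_hasArchParameter_glOne
  have hq : ∃ q : (K →+* ℂ) → ℂ, ∀ ι, χν ι = {q ι} := by
    have h1c : ∀ ι, ∃ a, χν ι = {a} := fun ι =>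
      Multiset.card_eq_one.mp (AutomorphicRepData.card_eq_of_hasArchParameter hχν ι)
    choose q hq using h1c
    exact ⟨q, hq⟩
  obtain ⟨q, hq⟩ := hq
  -- Step 3: the regular algebraic infinity type of `π`
  obtain ⟨T, ⟨hTwf, hTarch⟩, hTC, hTreg⟩ := hRA
  -- Step 4 (INPUT stub 2): the adjoint shadow at every embedding
  have hsh : ∀ ι, (T ι).map ArchWeight.a = {s₁ ι - s₂ ι + q ι, q ι, s₂ ι - s₁ ι + q ι} :=
    fun ι => hA K h1 hcpt₂ hcpt π σ₀ ν hAd _ _ _ hTarch hσ hχν ι (s₁ ι) (s₂ ι) (q ι) rfl (hq ι)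
  -- Step 5: integrality from C-algebraicity of `π` (`n = 3`: exponents in `1 + ℤ = ℤ`)
  have hint : ∀ ι, ∀ z ∈ (T ι).map ArchWeight.a, ∃ k : ℤ, z = k := by
    intro ι z hz
    obtain ⟨w, hw, rfl⟩ := Multiset.mem_map.mp hz
    obtain ⟨k, l, hk, -⟩ := hTC ι w hw
    exact ⟨k + 1, by rw [hk]; push_cast; ring⟩
  have hqZ : ∀ ι, ∃ k : ℤ, q ι = k := fun ι => hint ι (q ι) (by rw [hsh ι]; simp)
  have haZ : ∀ ι, ∃ k : ℤ, s₁ ι - s₂ ι = k := by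
    intro ι
    obtain ⟨k₁, hk₁⟩ := hint ι (s₁ ι - s₂ ι + q ι) (by rw [hsh ι]; simp)
    obtain ⟨k₂, hk₂⟩ := hqZ ι
    exact ⟨k₁ - k₂, by push_cast; linear_combination hk₁ - hk₂⟩
  -- Step 6: regularity of `π` forces `s₁ ι ≠ s₂ ι`
  have ha0 : ∀ ι, s₁ ι - s₂ ι ≠ 0 := by
    intro ι h0
    have hnd := hTreg ι
    rw [hsh ι, Multiset.insert_eq_cons, Multiset.nodup_cons] at hnd
    apply hnd.1
    rw [h0, zero_add]
    simp
  -- Step 7 (LEVER stub 1): parity, uniformly in `ι`, from the unitary mirror of `σ₀`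
  obtain ⟨c, hc⟩ := hM 2 K hcpt₂ σ₀ _ hσ
  have hpar : ∀ ι, ∃ m : ℤ, (s₁ ι - s₂ ι) +
      (s₁ (ComplexEmbedding.conjugate ι) - s₂ (ComplexEmbedding.conjugate ι)) = 2 * m := by
    intro ι
    obtain ⟨a, ha⟩ := haZ ι
    have h := hc ι
    simp only [Multiset.insert_eq_cons, Multiset.map_cons, Multiset.map_singleton] at h
    exact parity_of_mirror (c := c) ha (by simpa only [Multiset.insert_eq_cons] using h)
  -- Step 8 (stub 4): the central character of `σ₀` as a `GL(1)` datum with parameter `{s₁ ι + s₂ ι}`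
  obtain ⟨ω, hω⟩ := hC 2 K h1 hcpt₂ σ₀ _ hσ
  have hω' : ω.1.HasArchParameter (fun ι => {s₁ ι + s₂ ι}) := by
    have e : (fun ι : K →+* ℂ => ({(({s₁ ι, s₂ ι} : Multiset ℂ)).sum} : Multiset ℂ)) =
        fun ι => {s₁ ι + s₂ ι} := by
      funext ι
      simp
    rw [← e]
    exact hω
  -- Step 9 (stub 5 = route item HalfIntegralTwistCM): the half-integral twisting `GL(1)` datum `χ`
  obtain ⟨χ, p, hχ, hp⟩ := hH K hCM h1 s₁ s₂ haZ (fun ι => (hpair ι).1) hpar ⟨ω, hω'⟩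
  -- Step 10 (stub 6): realise `σ = σ₀ ⊗ χ`
  obtain ⟨σ, hσarch, hσsat⟩ := hT 2 K h1 hcpt₂ σ₀ χ _ p hσ hχ
  refine ⟨σ, χ, ?_, hσsat⟩
  -- Step 11: the regular algebraic certificate of `σ` (explicit well-formed infinity type)
  choose mp hmp using hp
  choose ma hma using haZ
  have hw₁ : ∀ ι, ∃ m : ℤ, (s₁ ι + p ι) -
      (s₁ (ComplexEmbedding.conjugate ι) + p (ComplexEmbedding.conjugate ι)) = m := fun ι =>
    ⟨mp ι - mp (ComplexEmbedding.conjugate ι), by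
      push_cast; linear_combination hmp ι - hmp (ComplexEmbedding.conjugate ι)⟩
  have hw₂ : ∀ ι, ∃ m : ℤ, (s₂ ι + p ι) -
      (s₂ (ComplexEmbedding.conjugate ι) + p (ComplexEmbedding.conjugate ι)) = m := fun ι =>
    ⟨mp ι - mp (ComplexEmbedding.conjugate ι) - ma ι + ma (ComplexEmbedding.conjugate ι), by
      push_cast
      linear_combination hmp ι - hmp (ComplexEmbedding.conjugate ι) - hma ι +
        hma (ComplexEmbedding.conjugate ι)⟩
  let Tσ : InfinityType K 2 := fun ι =>
    {⟨s₁ ι + p ι, s₁ (ComplexEmbedding.conjugate ι) + p (ComplexEmbedding.conjugate ι), hw₁ ι⟩,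
     ⟨s₂ ι + p ι, s₂ (ComplexEmbedding.conjugate ι) + p (ComplexEmbedding.conjugate ι), hw₂ ι⟩}
  have hTa : ∀ ι, (Tσ ι).map ArchWeight.a = {s₁ ι + p ι, s₂ ι + p ι} := fun ι => by simp [Tσ]
  refine ⟨Tσ, ⟨⟨fun ι => by simp [Tσ], fun ι => ?_⟩, ?_⟩, fun ι w hw => ?_, fun ι => ?_⟩
  · -- conj-swap compatibility
    have e : ComplexEmbedding.conjugate (ComplexEmbedding.conjugate ι) = ι := star_star ι
    simp only [Tσ, Multiset.insert_eq_cons, Multiset.map_cons, Multiset.map_singleton]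
    congr 1
    · ext <;> simp [ArchWeight.swap, e]
    · congr 1
      ext <;> simp [ArchWeight.swap, e]
  · -- the archimedean parameter of `σ`
    have e : (fun ι : K →+* ℂ => (Tσ ι).map ArchWeight.a) =
        fun ι => (({s₁ ι, s₂ ι} : Multiset ℂ)).map (· + p ι) := by
      funext ι
      rw [hTa ι]
      simp
    rw [e]
    exact hσarch
  · -- C-algebraic: all exponents in `1/2 + ℤ`
    simp only [Tσ, Multiset.insert_eq_cons, Multiset.mem_cons, Multiset.mem_singleton] at hw
    rcases hw with rfl | rfl
    · refine ⟨mp ι, mp (ComplexEmbedding.conjugate ι), ?_, ?_⟩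
      · show s₁ ι + p ι = _
        push_cast
        linear_combination hmp ι
      · show s₁ (ComplexEmbedding.conjugate ι) + p (ComplexEmbedding.conjugate ι) = _
        push_cast
        linear_combination hmp (ComplexEmbedding.conjugate ι)
    · refine ⟨mp ι - ma ι, mp (ComplexEmbedding.conjugate ι) - ma (ComplexEmbedding.conjugate ι), ?_, ?_⟩
      · show s₂ ι + p ι = _
        push_cast
        linear_combination hmp ι - hma ι
      · show s₂ (ComplexEmbedding.conjugate ι) + p (ComplexEmbedding.conjugate ι) = _
        push_cast
        linear_combination hmp (ComplexEmbedding.conjugate ι) - hma (ComplexEmbedding.conjugate ι)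
  · -- regular
    rw [hTa ι, Multiset.insert_eq_cons, Multiset.nodup_cons]
    refine ⟨?_, Multiset.nodup_singleton _⟩
    rw [Multiset.mem_singleton]
    intro h
    exact ha0 ι (by linear_combination h)

end Summit.Langlands.Langlands.Cruxes.RegularTwistCM.UnitaryMirrorParity

end
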